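import Summits.CriticalPhenomena.PercolationContinuityZ3.Theorems.PercNearOneGluingNoHeavyLowerTailIncStarCutVertex
import Summits.CriticalPhenomena.PercolationContinuityZ3.Theorems.PercNearOneGluingAdditiveGluingTieLiftOne
import Literature.Probability.Percolation.ShorteningInfluenceBound
import HarnessLib

/-!
# Root-pair chords at a separating vertex (B′-forest), I: walk lemmas, root-star events, restriction of weights

Support file for the Sahi programme (`--supports stmt-CriticalPhenomena-4575`, prover prim-sahi-p2 gen 19).  No definitions, no named
facts, no sorries; standard axioms.  Memo `prim-sahi-p2/PROOF-E3.md` (29n) and the blueprint in `prim-sahi-p2/gen19/README.md`; arithmetic core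
`…IncStarRootPairPoly` (`IncStar.rootPairChord_poly`).

Infrastructure for the event layer of B′-forest (the chord of `E₃` along a root pair `s(s, x)` at a vertex `x` separating the targets), where
the graph minus the root splits at the cut vertex `x` and the root connections are described by ROOT-STAR events
`{∃ u ∈ U, s(s,u) open ∧ u ↔ t inside V'}`:
* `openConn_iff_exists_firstStep` — `s ↔ t` (`t ≠ s`) iff some root pair `s(s,u)` is open and `u ↔ t` avoiding `s`;
* `openConn_avoid_or_through` — `x ↔ t` avoiding `s`, or else `s ↔ t`;
* `determinedBy_rootStar` — root-star events are determined by the pairs inside `V'` and the root pairs into `U`;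
* `real_update_eq_of_determinedBy`, `real_restrict_eq_of_determinedBy` — changing the weights OUTSIDE a determining set of pairs does not change the
  probability of the event (marginals of `prodBernoulli`; used to read the block functionals `Ψ_R`, `Br_a` of (29n) off restricted weights, to which
  `IncStar.psi_nonneg` / `IncStar.branchLemma` apply).
-/

noncomputable section

namespace Summit.CriticalPhenomena.PercolationContinuityZ3.Theorems

namespace IncStar

open MeasureTheory Set Literature.Probability.Percolation Literature.Probability.LatticeModels
open scoped Classical

variable {n : ℕ}

/-! ### Walk lemmas -/

/-- **First-step decomposition of a root connection**: for `t ≠ s`, `s ↔ t` iff some pair `s(s, u)` is open and `u ↔ t` by an open path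
avoiding `s`. [folklore] -/
theorem openConn_iff_exists_firstStep {ω : BondConfig (Fin n)} {s t : Fin n} (hts : t ≠ s) :
    ω ∈ openConn s t ↔ ∃ u : Fin n, u ≠ s ∧ s(s, u) ∈ ω ∧ ω ∈ openConnIn {y | y ≠ s} u t := by
  constructor
  · rintro ⟨p⟩
    have key : ∀ q : (openGraph ω).Walk s t, q.IsPath →
        ∃ u : Fin n, (openGraph ω).Adj s u ∧ ∃ r : (openGraph ω).Walk u t, s ∉ r.support := by
      intro q hq
      cases q with
      | nil => exact absurd rfl hts
      | cons hadj r =>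
        rename_i u
        exact ⟨u, hadj, r, ((SimpleGraph.Walk.cons_isPath_iff hadj r).1 hq).2⟩
    obtain ⟨u, hadj, r, hr⟩ := key p.bypass p.bypass_isPath
    have hadj' := (openGraph_adj ω s u).1 hadj
    refine ⟨u, hadj'.2.symm, hadj'.1, mem_openConnIn_of_openWalk r fun z hz => ?_⟩
    intro hzs
    exact hr (hzs ▸ hz)
  · rintro ⟨u, hus, hsu, h⟩
    obtain ⟨r, -⟩ := BlockExploration.exists_openWalk_of_mem_openConnIn h
    exact ⟨SimpleGraph.Walk.cons ((openGraph_adj ω s u).2 ⟨hsu, hus.symm⟩) r⟩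

/-- **Avoid-or-through**: an open path from `x` to `t` either avoids `s` or exhibits `s ↔ t`. [folklore] -/
theorem openConn_avoid_or_through {ω : BondConfig (Fin n)} (s : Fin n) {x t : Fin n} (h : ω ∈ openConn x t) :
    ω ∈ openConnIn {y | y ≠ s} x t ∨ ω ∈ openConn s t := by
  obtain ⟨p⟩ := h
  by_cases hs : s ∈ p.support
  · exact Or.inr ⟨p.dropUntil s hs⟩
  · refine Or.inl (mem_openConnIn_of_openWalk p fun z hz => ?_)
    intro hzs
    exact hs (hzs ▸ hz)

/-- `{x ↔ t avoiding s} ⊆ {x ↔ t}`. [folklore] -/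
theorem openConn_of_openConnIn {ω : BondConfig (Fin n)} {S : Set (Fin n)} {x t : Fin n} (h : ω ∈ openConnIn S x t) :
    ω ∈ openConn x t := by
  obtain ⟨r, -⟩ := BlockExploration.exists_openWalk_of_mem_openConnIn h
  exact ⟨r⟩

/-! ### Root-star events -/

/-- **Root-star events are local**: `{∃ u ∈ U, s(s,u) open ∧ u ↔ t inside V'}` is determined by the off-diagonal pairs inside `V'` together with
the root pairs `s(s, u)`, `u ∈ U`. [this work] -/
theorem determinedBy_rootStar (U V' : Set (Fin n)) (s t : Fin n) :
    DeterminedBy {ω : BondConfig (Fin n) | ∃ u ∈ U, s(s, u) ∈ ω ∧ ω ∈ openConnIn V' u t}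
      ({z : Sym2 (Fin n) | ¬ z.IsDiag ∧ ∀ v ∈ z, v ∈ V'} ∪ {z | ∃ u ∈ U, z = s(s, u)}) := by
  have key : ∀ ω ω' : BondConfig (Fin n),
      ω ∩ ({z : Sym2 (Fin n) | ¬ z.IsDiag ∧ ∀ v ∈ z, v ∈ V'} ∪ {z | ∃ u ∈ U, z = s(s, u)})
        = ω' ∩ ({z : Sym2 (Fin n) | ¬ z.IsDiag ∧ ∀ v ∈ z, v ∈ V'} ∪ {z | ∃ u ∈ U, z = s(s, u)}) →
      (∃ u ∈ U, s(s, u) ∈ ω ∧ ω ∈ openConnIn V' u t) → ∃ u ∈ U, s(s, u) ∈ ω' ∧ ω' ∈ openConnIn V' u t := by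
    intro ω ω' h
    rintro ⟨u, hu, hsu, hc⟩
    have hmem : s(s, u) ∈ ω' := by
      have h1 : s(s, u) ∈ ω ∩ ({z : Sym2 (Fin n) | ¬ z.IsDiag ∧ ∀ v ∈ z, v ∈ V'} ∪ {z | ∃ u ∈ U, z = s(s, u)}) :=
        ⟨hsu, Or.inr ⟨u, hu, rfl⟩⟩
      rw [h] at h1
      exact h1.1
    have hdet : DeterminedBy (openConnIn V' u t : Set (BondConfig (Fin n)))
        ({z : Sym2 (Fin n) | ¬ z.IsDiag ∧ ∀ v ∈ z, v ∈ V'} ∪ {z | ∃ u ∈ U, z = s(s, u)}) :=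
      (IncStarCutVertex.determinedBy_openConnIn_offDiag V' u t).mono Set.subset_union_left
    rw [determinedBy_iff] at hdet
    exact ⟨u, hu, hmem, (hdet ω ω' h).1 hc⟩
  rw [determinedBy_iff]
  intro ω ω' h
  exact ⟨key ω ω' h, key ω' ω h.symm⟩

/-! ### Marginals: weights outside a determining set do not matter -/

/-- **Changing one weight outside a determining set of pairs does not change the probability.** [folklore] -/
theorem real_update_eq_of_determinedBy {A : Set (BondConfig (Fin n))} {K : Set (Sym2 (Fin n))} (hA : DeterminedBy A K)
    (w : Sym2 (Fin n) → unitInterval) {e : Sym2 (Fin n)} (he : e ∉ K) (val : unitInterval) :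
    (prodBernoulli (Function.update w e val)).real A = (prodBernoulli w).real A := by
  have hAu : DeterminedBy A (↑(Finset.univ : Finset (Sym2 (Fin n))) : Set (Sym2 (Fin n))) := by
    rw [determinedBy_iff]
    intro ω ω' h
    rw [Finset.coe_univ, Set.inter_univ, Set.inter_univ] at h
    rw [h]
  have hpre : ((fun ω : BondConfig (Fin n) => insert e ω) ⁻¹' A) = A := by
    ext ω
    rw [Set.mem_preimage]
    rw [determinedBy_iff] at hA
    refine hA _ _ ?_
    ext z
    simp only [Set.mem_inter_iff, Set.mem_insert_iff]
    constructor
    · rintro ⟨hz | hz, hzK⟩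
      · exact absurd hzK (hz ▸ he)
      · exact ⟨hz, hzK⟩
    · rintro ⟨hz, hzK⟩
      exact ⟨Or.inr hz, hzK⟩
  -- both sides equal the probability under `w[e ↦ 0]`
  have collapse : ∀ w' : Sym2 (Fin n) → unitInterval,
      (prodBernoulli w').real A = (prodBernoulli (Function.update w' e 0)).real A := by
    intro w'
    have h1 : (prodBernoulli (Function.update w' e 1)).real A = (prodBernoulli (Function.update w' e 0)).real A := by
      rw [tieLiftOne_real_one_eq, hpre]
    rw [prodBernoulli_real_oneBond hAu w' (Finset.mem_univ e), h1]
    ring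
  rw [collapse (Function.update w e val), collapse w, Function.update_idem]

/-- **Restriction to a determining set**: zeroing all weights outside `K` does not change the probability of an event determined by `K`.
[folklore] -/
theorem real_restrict_eq_of_determinedBy {A : Set (BondConfig (Fin n))} {K : Set (Sym2 (Fin n))} (hA : DeterminedBy A K)
    (w : Sym2 (Fin n) → unitInterval) :
    (prodBernoulli (fun z => if z ∈ K then w z else 0)).real A = (prodBernoulli w).real A := by
  suffices H : ∀ (N : ℕ) (w' : Sym2 (Fin n) → unitInterval),
      (Finset.univ.filter fun z : Sym2 (Fin n) => z ∉ K ∧ w' z ≠ 0).card ≤ N →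
      (prodBernoulli (fun z => if z ∈ K then w' z else 0)).real A = (prodBernoulli w').real A from
    H _ w le_rfl
  intro N
  induction N with
  | zero =>
    intro w' hN
    have hzero : ∀ z, z ∉ K → w' z = 0 := by
      intro z hzK
      by_contra hne
      have hmem : z ∈ Finset.univ.filter (fun z : Sym2 (Fin n) => z ∉ K ∧ w' z ≠ 0) :=
        Finset.mem_filter.2 ⟨Finset.mem_univ _, hzK, hne⟩
      have := Finset.card_pos.2 ⟨z, hmem⟩
      omega
    have hw : (fun z => if z ∈ K then w' z else 0) = w' := by
      funext z
      by_cases hz : z ∈ K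
      · rw [if_pos hz]
      · rw [if_neg hz, hzero z hz]
    rw [hw]
  | succ N ih =>
    intro w' hN
    by_cases hempty : (Finset.univ.filter fun z : Sym2 (Fin n) => z ∉ K ∧ w' z ≠ 0) = ∅
    · exact ih w' (by rw [hempty, Finset.card_empty]; exact Nat.zero_le _)
    obtain ⟨z₀, hz₀⟩ := Finset.nonempty_iff_ne_empty.2 hempty
    obtain ⟨-, hz₀K, hz₀w⟩ := Finset.mem_filter.1 hz₀
    -- zero out `z₀`
    have hres : (fun z => if z ∈ K then Function.update w' z₀ 0 z else 0) = (fun z => if z ∈ K then w' z else 0) := by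
      funext z
      by_cases hz : z ∈ K
      · have hne : z ≠ z₀ := fun h => hz₀K (h ▸ hz)
        rw [if_pos hz, if_pos hz, Function.update_of_ne hne]
      · rw [if_neg hz, if_neg hz]
    have hlt : (Finset.univ.filter fun z : Sym2 (Fin n) => z ∉ K ∧ Function.update w' z₀ 0 z ≠ 0).card
        < (Finset.univ.filter fun z : Sym2 (Fin n) => z ∉ K ∧ w' z ≠ 0).card := by
      apply Finset.card_lt_card
      refine ⟨fun z hz => ?_, fun hsub => ?_⟩
      · obtain ⟨-, hzK, hzw⟩ := Finset.mem_filter.1 hz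
        have hne : z ≠ z₀ := by
          intro h
          rw [h, Function.update_self] at hzw
          exact hzw rfl
        rw [Function.update_of_ne hne] at hzw
        exact Finset.mem_filter.2 ⟨Finset.mem_univ _, hzK, hzw⟩
      · have h := (Finset.mem_filter.1 (hsub hz₀)).2.2
        rw [Function.update_self] at h
        exact h rfl
    rw [← hres, ih _ (by omega), real_update_eq_of_determinedBy hA w' hz₀K 0]

end IncStar

end Summit.CriticalPhenomena.PercolationContinuityZ3.Theorems
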